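import Summits.FinalStateConjecture.FinalStateConjecture.Theorems.EIHFluxBalanceInertialRecessionStubQuasiStationarityBound

/-!
# Route EIHFluxBalance — `InertialRecession`, line `sublinear-is-free-clean-window-charges`,
# stub `stub_weightedRates`: the 4-velocity channel of `∂₀` is ATTAINED (lower bound)

Helper file of the worker on `stub_weightedRates` (crux `stmt-FinalStateConjecture-10166`). The
reductions `stub_quasiStationarity_of_weightedRates(_e0)` derive quasi-stationarity QS from the
weighted 4-velocity rates `t^{3/4}‖(Λᵢe₀)˙‖ → 0` through the UPPER bound
`‖D S(x)[e₀]‖ ≲ M‖Λ̇e₀‖/d + …`. This file proves the matching LOWER bound for a Schwarzschild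
summand (`a = 0`): along the time line through the lab point `x = (t, ξ(t) + z)` and on the pair
`(u, u)`, `u = Λ(t)e₀`, the lab-time derivative of the painted summand is EXPLICIT,

  `D S(x)[e₀](u, u) = 2M (⟪p̲, b̲⟫ (p⁰/ρ³ − 2/ρ²) + ⟪p̲, e̲⟫/ρ³)`,
  `p = Λ(t)⁻¹(0, z)`, `ρ = ‖p̲‖`, `b = Λ(t)⁻¹Λ̇(t)e₀` (the 4-acceleration in the body frame),
  `e = Λ(t)⁻¹(0, ξ̇(t))`,

(`hasDerivAt_schwarzschild_scalar_family`, `fderiv_summand_apply_self_eq`). The companion file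
`…StubWeightedRatesNecessityRate` bounds it below by `2|M| |⟪p̲, b̲⟫|/ρ² − 2|M|(1+3γ)‖ξ̇‖/ρ²`, aligns
`p̲ ∥ b̲` (the kernel `M/d` of the 4-velocity rate is ATTAINED) and turns this into
"QS ⇒ weighted 4-velocity rate" for one hole: the dynamical input RATES_E0 of the reduction is
also necessary.
-/

set_option linter.dupNamespace false

noncomputable section

namespace Summit.FinalStateConjecture.FinalStateConjecture.Theorems.SublinearIsFree.WeightedRates

open scoped BigOperators Topology ContDiff InnerProductSpace
open Filter Set Function Literature.Geometry.Lorentzian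
open Summit.FinalStateConjecture.FinalStateConjecture.Theorems
open Summit.FinalStateConjecture.FinalStateConjecture.Theorems.InertialRecession.Negative
open Summit.FinalStateConjecture.FinalStateConjecture.Theorems.SublinearIsFree.QuasiStationarity

/-! ### Algebra of the Schwarzschild form and of `so(1,3)` -/

/-- The Euclidean pairing of spatial parts in coordinates. [folklore] -/
theorem inner_spatial_eq_sum (y u : E4) :
    ⟪E4.spatial y, E4.spatial u⟫_ℝ = ∑ i : Fin 3, y i.succ * u i.succ := by
  simp [PiLp.inner_apply, E4.spatial_apply, mul_comm]

/-- For `a = 0` the Kerr–Schild scalar is `H = M/‖y̲‖` (off the centre). [cite: KerrSchild1965, §2] -/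
theorem wr_scalarH_zero_spin (M : ℝ) {y : E4} (hy : E4.spatialNorm y ≠ 0) :
    Kerr.scalarH M 0 y = M / E4.spatialNorm y := by
  unfold Kerr.scalarH
  rw [Kerr.radius_zero_left]
  field_simp
  ring

/-- **The Schwarzschild Kerr–Schild perturbation in closed form**:
`(g_{M,0} − η)(y)(v, w) = 2 (M/‖y̲‖) ℓ(v) ℓ(w)` with `ℓ(v) = v⁰ + ⟪y̲, v̲⟫/‖y̲‖` (off the centre).
[cite: KerrSchild1965, §2] -/
theorem ksPert_zero_spin_apply (M : ℝ) {y : E4} (hy : E4.spatialNorm y ≠ 0) (v w : E4) :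
    (Kerr.bilin M 0 y - Minkowski.bilin) v w =
      2 * (M / E4.spatialNorm y) *
        ((v 0 + ⟪E4.spatial y, E4.spatial v⟫_ℝ / E4.spatialNorm y) *
          (w 0 + ⟪E4.spatial y, E4.spatial w⟫_ℝ / E4.spatialNorm y)) := by
  rw [show (Kerr.bilin M 0 y - Minkowski.bilin) v w = Kerr.bilin M 0 y v w - Minkowski.bilin v w from rfl,
    Kerr.bilin_apply,
    wr_scalarH_zero_spin M hy, nullCovector_zero_spin_apply, nullCovector_zero_spin_apply,
    inner_spatial_eq_sum, inner_spatial_eq_sum]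
  ring

/-- For `η`-antisymmetric `S`: `(S e₀)⁰ = 0`. [folklore] -/
theorem bodyRate_apply_zero_zero (S : E4 →L[ℝ] E4)
    (hS : ∀ v w, Minkowski.bilin (S v) w + Minkowski.bilin v (S w) = 0) :
    S (E4.basisVector 0) 0 = 0 := by
  have h := hS (E4.basisVector 0) (E4.basisVector 0)
  rw [minkowski_components, minkowski_components] at h
  simp at h
  linarith

/-- **The spatial block of an `η`-antisymmetric operator is antisymmetric**: for every `p`,
`⟪p̲, (S p)̲⟫ = p⁰ ⟪p̲, (S e₀)̲⟫` (the rotation part of `S` is invisible along `p̲`, the boost part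
`b = S e₀` enters through `p⁰ b̲`). [folklore] -/
theorem inner_spatial_bodyRate_apply (S : E4 →L[ℝ] E4)
    (hS : ∀ v w, Minkowski.bilin (S v) w + Minkowski.bilin v (S w) = 0) (p : E4) :
    ⟪E4.spatial p, E4.spatial (S p)⟫_ℝ = p 0 * ⟪E4.spatial p, E4.spatial (S (E4.basisVector 0))⟫_ℝ := by
  obtain ⟨c11, c22, c33, -, -, -, c21, c13, c23⟩ := so13_components S hS
  have hp : S p = p 0 • S (E4.basisVector 0) + p 1 • S (E4.basisVector 1) +
      p 2 • S (E4.basisVector 2) + p 3 • S (E4.basisVector 3) := by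
    conv_lhs => rw [eq_sum_basisVector p]
    simp only [map_add, map_smul]
  rw [inner_spatial_eq_sum, inner_spatial_eq_sum, hp]
  simp only [Fin.sum_univ_three, PiLp.add_apply, PiLp.smul_apply, smul_eq_mul,
    show (0 : Fin 3).succ = 1 from rfl, show (1 : Fin 3).succ = 2 from rfl,
    show (2 : Fin 3).succ = 3 from rfl, c11, c22, c33, c21, c13, c23]
  ring

/-- The rest-frame position `p = Λ⁻¹(0, z)` is spacelike with `η(p, p) = ‖z‖²`, so
`|p⁰| ≤ ‖p̲‖` and `‖z‖ ≤ ‖p̲‖`. [folklore] -/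
theorem abs_apply_zero_le_spatialNorm_restPosition (Λ : lorentzGroup) (z : E3) :
    |((((Λ : E4 ≃L[ℝ] E4).symm : E4 →L[ℝ] E4)) (E4.spaceEmbed z)) 0| ≤
      E4.spatialNorm ((((Λ : E4 ≃L[ℝ] E4).symm : E4 →L[ℝ] E4)) (E4.spaceEmbed z)) := by
  set p := (((Λ : E4 ≃L[ℝ] E4).symm : E4 →L[ℝ] E4)) (E4.spaceEmbed z) with hp
  have hη : Minkowski.bilin p p = Minkowski.bilin (E4.spaceEmbed z) (E4.spaceEmbed z) := by
    have h := minkowski_symm_apply_left Λ (E4.spaceEmbed z) p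
    rw [hp, ContinuousLinearEquiv.coe_coe, ContinuousLinearEquiv.apply_symm_apply] at h
    rw [hp, ContinuousLinearEquiv.coe_coe]
    exact h
  have h1 : Minkowski.bilin p p = -(p 0 * p 0) + E4.spatialNorm p ^ 2 := by
    rw [minkowski_components, E4.spatialNorm_sq]; ring
  have h2 : Minkowski.bilin (E4.spaceEmbed z) (E4.spaceEmbed z) = ‖z‖ ^ 2 := by
    rw [minkowski_components, E4.spaceEmbed_apply]
    simp only [E4.ofTimeSpace_apply_zero, mul_zero, neg_zero, zero_add]
    simp only [show (1 : Fin 4) = (0 : Fin 3).succ from rfl,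
      show (2 : Fin 4) = (1 : Fin 3).succ from rfl, show (3 : Fin 4) = (2 : Fin 3).succ from rfl,
      E4.ofTimeSpace_apply_succ]
    rw [EuclideanSpace.real_norm_sq_eq, Fin.sum_univ_three]
    ring
  have hsq : p 0 ^ 2 ≤ E4.spatialNorm p ^ 2 := by nlinarith [h1, h2, hη, sq_nonneg ‖z‖]
  exact abs_le_of_sq_le_sq (by simpa using hsq) (E4.spatialNorm_nonneg p)

/-! ### The Schwarzschild scalar family along the time line, in closed form -/

/-- **One-variable calculus of the closed-form scalar family.** For real `C¹`-type data at `t`: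
curves `m̲ : ℝ → E3` (rest-frame position, `m̲(t) = p̲ ≠ 0`), `n⁰ : ℝ → ℝ`, `n̲ : ℝ → E3`
(components of the framed vector, `n⁰(t) = 1`, `n̲(t) = 0`) with derivatives `q̲`, `ν₀`, `−b̲` at `t`,
and `ν₀ = 0`: the function `s ↦ 2 (M/‖m̲ s‖) (n⁰ s + ⟪m̲ s, n̲ s⟫/‖m̲ s‖)²` has derivative
`2M(−⟪p̲, q̲⟫/‖p̲‖³ − 2⟪p̲, b̲⟫/‖p̲‖²)` at `t`. [folklore] -/
theorem hasDerivAt_closedForm (M : ℝ) {mbar nbar : ℝ → E3} {n0 : ℝ → ℝ} {t : ℝ} {pbar qbar bbar : E3}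
    (hm : HasDerivAt mbar qbar t) (hmt : mbar t = pbar) (hp : pbar ≠ 0)
    (hn0 : HasDerivAt n0 0 t) (hn0t : n0 t = 1)
    (hnb : HasDerivAt nbar (-bbar) t) (hnbt : nbar t = 0) :
    HasDerivAt (fun s ↦ 2 * (M / ‖mbar s‖) * (n0 s + ⟪mbar s, nbar s⟫_ℝ / ‖mbar s‖) ^ 2)
      (2 * M * (-⟪pbar, qbar⟫_ℝ / ‖pbar‖ ^ 3 - 2 * ⟪pbar, bbar⟫_ℝ / ‖pbar‖ ^ 2)) t := by
  have hρ0 : 0 < ‖pbar‖ := norm_pos_iff.mpr hp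
  -- `R(s) = ‖m̲ s‖ = √⟪m̲, m̲⟫`
  have hR2 : HasDerivAt (fun s ↦ ⟪mbar s, mbar s⟫_ℝ) (⟪pbar, qbar⟫_ℝ + ⟪qbar, pbar⟫_ℝ) t := by
    have h := hm.inner ℝ hm
    rw [hmt] at h
    exact h
  have hR2t : ⟪mbar t, mbar t⟫_ℝ = ‖pbar‖ ^ 2 := by rw [hmt, real_inner_self_eq_norm_sq]
  have hR2ne : ⟪mbar t, mbar t⟫_ℝ ≠ 0 := by rw [hR2t]; positivity
  have hR : HasDerivAt (fun s ↦ ‖mbar s‖) (⟪pbar, qbar⟫_ℝ / ‖pbar‖) t := by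
    have h := hR2.sqrt hR2ne
    have hfun : (fun s ↦ √⟪mbar s, mbar s⟫_ℝ) = fun s ↦ ‖mbar s‖ := by
      funext s; rw [norm_eq_sqrt_real_inner]
    rw [hfun, hR2t, Real.sqrt_sq hρ0.le, real_inner_comm pbar qbar] at h
    refine h.congr_deriv ?_
    field_simp
    ring
  have hRt : (fun s ↦ ‖mbar s‖) t = ‖pbar‖ := by simp [hmt]
  -- `L(s) = n⁰ s + ⟪m̲, n̲⟫/R`
  have hI : HasDerivAt (fun s ↦ ⟪mbar s, nbar s⟫_ℝ) (-⟪pbar, bbar⟫_ℝ) t := by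
    have h := hm.inner ℝ hnb
    rw [hmt, hnbt, inner_zero_right, add_zero, inner_neg_right] at h
    exact h
  have hQ : HasDerivAt (fun s ↦ ⟪mbar s, nbar s⟫_ℝ / ‖mbar s‖) (-⟪pbar, bbar⟫_ℝ / ‖pbar‖) t := by
    have h := hI.div hR (by rw [hmt]; exact hρ0.ne')
    rw [hmt, hnbt, inner_zero_right] at h
    refine h.congr_deriv ?_
    field_simp
    ring
  have hL : HasDerivAt (fun s ↦ n0 s + ⟪mbar s, nbar s⟫_ℝ / ‖mbar s‖)
      (0 + -⟪pbar, bbar⟫_ℝ / ‖pbar‖) t := hn0.add hQ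
  have hLt : n0 t + ⟪mbar t, nbar t⟫_ℝ / ‖mbar t‖ = 1 := by
    rw [hn0t, hnbt, inner_zero_right, zero_div, add_zero]
  have hL2 : HasDerivAt (fun s ↦ (n0 s + ⟪mbar s, nbar s⟫_ℝ / ‖mbar s‖) ^ 2)
      ((2 : ℕ) * (n0 t + ⟪mbar t, nbar t⟫_ℝ / ‖mbar t‖) ^ (2 - 1) *
        (0 + -⟪pbar, bbar⟫_ℝ / ‖pbar‖)) t := hL.fun_pow 2
  rw [hLt] at hL2
  -- `2M/R`
  have hK : HasDerivAt (fun s ↦ 2 * (M / ‖mbar s‖))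
      (2 * (-(M * (⟪pbar, qbar⟫_ℝ / ‖pbar‖)) / ‖pbar‖ ^ 2)) t := by
    have h := ((hasDerivAt_const t M).div hR (by rw [hmt]; exact hρ0.ne')).const_mul 2
    rw [hmt] at h
    refine h.congr_deriv ?_
    ring
  have hprod := hK.mul hL2
  simp only [hmt, hn0t, hnbt, inner_zero_right] at hprod
  refine hprod.congr_deriv ?_
  push_cast
  field_simp
  ring

-- operator-norm instance paths on form-valued maps are slow to unify
set_option synthInstance.maxHeartbeats 200000 in
set_option maxHeartbeats 800000 in
/-- **The Schwarzschild scalar family along the time line has an explicit derivative.** For a `C¹`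
Lorentz motion `Λ` (as operators, derivative `Λ̇(t)`), a `C¹` centre `ξ` and a spatial point `z ≠ ξ(t)`,
with `A(s) = Λ(s)⁻¹`, `u = Λ(t)e₀`, `p = A(t)(0, z − ξ(t))`, `b = A(t)Λ̇(t)e₀`,
`q = −A(t)Λ̇(t)p + A(t)(0, −ξ̇(t))`, `ρ = ‖p̲‖`:
`d/ds|ₜ (g_{M,0} − η)(A(s)(0, z − ξ(s)))(A(s)u, A(s)u) = 2M(−⟪p̲, q̲⟫/ρ³ − 2⟪p̲, b̲⟫/ρ²)`
(closed form `2(M/‖m̲‖)(n⁰ + ⟪m̲, n̲⟫/‖m̲‖)²` of the family, `hasDerivAt_closedForm`; at `s = t` the framed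
vector is `e₀`, its derivative `−b` has vanishing time component). [cite: KerrSchild1965, §2] -/
theorem hasDerivAt_schwarzschild_scalar_family (M : ℝ) {Λ : ℝ → lorentzGroup} {ξ : ℝ → E3} {t : ℝ}
    (hΛ : ContDiff ℝ 1 (fun s ↦ ((Λ s : E4 ≃L[ℝ] E4) : E4 →L[ℝ] E4))) (hξ : ContDiff ℝ 1 ξ)
    (z : E3) (hz : z - ξ t ≠ 0) :
    HasDerivAt (fun s ↦ (Kerr.bilin M 0 ((((Λ s : E4 ≃L[ℝ] E4).symm : E4 →L[ℝ] E4))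
        (E4.spaceEmbed (z - ξ s))) - Minkowski.bilin)
        ((((Λ s : E4 ≃L[ℝ] E4).symm : E4 →L[ℝ] E4)) ((Λ t : E4 ≃L[ℝ] E4) (E4.basisVector 0)))
        ((((Λ s : E4 ≃L[ℝ] E4).symm : E4 →L[ℝ] E4)) ((Λ t : E4 ≃L[ℝ] E4) (E4.basisVector 0))))
      (2 * M * (-⟪E4.spatial ((((Λ t : E4 ≃L[ℝ] E4).symm : E4 →L[ℝ] E4)) (E4.spaceEmbed (z - ξ t))),
          E4.spatial (-((((Λ t : E4 ≃L[ℝ] E4).symm : E4 →L[ℝ] E4))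
            (deriv (fun s ↦ ((Λ s : E4 ≃L[ℝ] E4) : E4 →L[ℝ] E4)) t
              ((((Λ t : E4 ≃L[ℝ] E4).symm : E4 →L[ℝ] E4)) (E4.spaceEmbed (z - ξ t))))) +
            (((Λ t : E4 ≃L[ℝ] E4).symm : E4 →L[ℝ] E4)) (E4.spaceEmbed (-deriv ξ t)))⟫_ℝ /
          E4.spatialNorm ((((Λ t : E4 ≃L[ℝ] E4).symm : E4 →L[ℝ] E4)) (E4.spaceEmbed (z - ξ t))) ^ 3 -
        2 * ⟪E4.spatial ((((Λ t : E4 ≃L[ℝ] E4).symm : E4 →L[ℝ] E4)) (E4.spaceEmbed (z - ξ t))),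
          E4.spatial ((((Λ t : E4 ≃L[ℝ] E4).symm : E4 →L[ℝ] E4))
            (deriv (fun s ↦ ((Λ s : E4 ≃L[ℝ] E4) : E4 →L[ℝ] E4)) t (E4.basisVector 0)))⟫_ℝ /
          E4.spatialNorm ((((Λ t : E4 ≃L[ℝ] E4).symm : E4 →L[ℝ] E4)) (E4.spaceEmbed (z - ξ t))) ^ 2))
      t := by
  set Lpath : ℝ → E4 →L[ℝ] E4 := fun s ↦ ((Λ s : E4 ≃L[ℝ] E4) : E4 →L[ℝ] E4) with hLpath
  set Apath : ℝ → E4 →L[ℝ] E4 := fun s ↦ (((Λ s : E4 ≃L[ℝ] E4).symm : E4 →L[ℝ] E4)) with hApath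
  set A : E4 →L[ℝ] E4 := (((Λ t : E4 ≃L[ℝ] E4).symm : E4 →L[ℝ] E4)) with hAdef
  set L' : E4 →L[ℝ] E4 := deriv Lpath t with hL'
  set u : E4 := (Λ t : E4 ≃L[ℝ] E4) (E4.basisVector 0) with hu
  set p : E4 := A (E4.spaceEmbed (z - ξ t)) with hpdef
  set b : E4 := A (L' (E4.basisVector 0)) with hb
  set q : E4 := -(A (L' p)) + A (E4.spaceEmbed (-deriv ξ t)) with hq
  -- derivatives of the paths
  have hΛ' : HasDerivAt Lpath L' t := (hΛ.differentiable one_ne_zero t).hasDerivAt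
  have hA : HasDerivAt Apath (-(A.comp (L'.comp A))) t := hasDerivAt_lorentz_symm one_ne_zero hΛ hΛ'
  have hξ' : HasDerivAt ξ (deriv ξ t) t := (hξ.differentiable one_ne_zero t).hasDerivAt
  have hAu : A u = E4.basisVector 0 := by
    rw [hAdef, hu, ContinuousLinearEquiv.coe_coe, ContinuousLinearEquiv.symm_apply_apply]
  -- the rest-frame position `m(s)` and the framed vector `n(s)`
  have hsq : HasDerivAt (fun s ↦ E4.spaceEmbed (z - ξ s)) (E4.spaceEmbed (-deriv ξ t)) t :=
    E4.spaceEmbed.hasFDerivAt.comp_hasDerivAt t (hξ'.const_sub z)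
  have hm : HasDerivAt (fun s ↦ Apath s (E4.spaceEmbed (z - ξ s))) q t := by
    have h := hA.clm_apply hsq
    refine h.congr_deriv ?_
    simp [hq, hpdef, hApath, hAdef]
  have hn : HasDerivAt (fun s ↦ Apath s u) (-b) t := by
    have h := hA.clm_apply (hasDerivAt_const t u)
    refine h.congr_deriv ?_
    simp [hb, hu, hApath, hAdef]
  have hmbar : HasDerivAt (fun s ↦ E4.spatial (Apath s (E4.spaceEmbed (z - ξ s)))) (E4.spatial q) t :=
    E4.spatial.hasFDerivAt.comp_hasDerivAt t hm
  have hnbar : HasDerivAt (fun s ↦ E4.spatial (Apath s u)) (-(E4.spatial b)) t := by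
    have h := E4.spatial.hasFDerivAt.comp_hasDerivAt t hn
    rw [map_neg] at h
    exact h
  have hW : ∀ v w, Minkowski.bilin ((A.comp L') v) w + Minkowski.bilin v ((A.comp L') w) = 0 :=
    fun v w ↦ by
    have h := minkowski_bodyRate_antisymm hΛ' v w
    simpa [hAdef] using h
  have hb0 : b 0 = 0 := by
    have h := bodyRate_apply_zero_zero (A.comp L') hW
    simpa [hb] using h
  have hn0 : HasDerivAt (fun s ↦ (Apath s u) 0) 0 t := by
    have h := (EuclideanSpace.proj (0 : Fin 4) : E4 →L[ℝ] ℝ).hasFDerivAt.comp_hasDerivAt t hn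
    have hval : (EuclideanSpace.proj (0 : Fin 4) : E4 →L[ℝ] ℝ) (-b) = 0 := by
      simp [hb0]
    rw [hval] at h
    exact h
  -- values at `s = t`
  have hmt : E4.spatial (Apath t (E4.spaceEmbed (z - ξ t))) = E4.spatial p := rfl
  have hn0t : (Apath t u) 0 = 1 := by
    show (A u) 0 = 1
    rw [hAu]; simp
  have hnbt : E4.spatial (Apath t u) = 0 := by
    show E4.spatial (A u) = 0
    rw [hAu]; ext i; simp [E4.spatial_apply]
  have hρ : ‖z - ξ t‖ ≤ E4.spatialNorm p := le_spatialNorm_restPosition (Λ t) _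
  have hρ0 : 0 < E4.spatialNorm p := (norm_pos_iff.mpr hz).trans_le hρ
  have hp0 : E4.spatial p ≠ 0 := by
    intro h
    have : E4.spatialNorm p = 0 := by rw [E4.spatialNorm, h, norm_zero]
    linarith
  -- the closed form and its derivative
  have hcf := hasDerivAt_closedForm M hmbar hmt hp0 hn0 hn0t hnbar hnbt
  -- the family agrees with the closed form near `t`
  have hev : ∀ᶠ s in 𝓝 t, 0 < ‖E4.spatial (Apath s (E4.spaceEmbed (z - ξ s)))‖ := by
    have hc : ContinuousAt (fun s ↦ ‖E4.spatial (Apath s (E4.spaceEmbed (z - ξ s)))‖) t :=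
      hmbar.continuousAt.norm
    have h0 : (0 : ℝ) < ‖E4.spatial (Apath t (E4.spaceEmbed (z - ξ t)))‖ := hρ0
    exact hc.eventually (lt_mem_nhds h0)
  have heq : (fun s ↦ (Kerr.bilin M 0 (Apath s (E4.spaceEmbed (z - ξ s))) - Minkowski.bilin)
      (Apath s u) (Apath s u)) =ᶠ[𝓝 t]
      fun s ↦ 2 * (M / ‖E4.spatial (Apath s (E4.spaceEmbed (z - ξ s)))‖) *
        ((Apath s u) 0 + ⟪E4.spatial (Apath s (E4.spaceEmbed (z - ξ s))), E4.spatial (Apath s u)⟫_ℝ /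
          ‖E4.spatial (Apath s (E4.spaceEmbed (z - ξ s)))‖) ^ 2 := by
    filter_upwards [hev] with s hs
    rw [ksPert_zero_spin_apply M (by rw [E4.spatialNorm]; exact hs.ne'), sq]
    rfl
  exact hcf.congr_of_eventuallyEq heq

/-! ### `∂₀S(x)(u, u)` in closed form and its lower bound -/

-- operator-norm instance paths on form-valued maps are slow to unify
set_option synthInstance.maxHeartbeats 200000 in
/-- **`∂₀S(x)(u, u)` in closed form** for the Schwarzschild summand
`S(y) = boostedKerrBilin (Λ(y⁰)) (y⁰, ξ(y⁰)) M 0 y − η` at a slab point `x` (`x⁰ = t`,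
`‖x̲ − ξ(t)‖ ≥ 1`), on the pair `(u, u)`, `u = Λ(t)e₀`: with `A = Λ(t)⁻¹`, `p = A(0, x̲ − ξ(t))`,
`b = AΛ̇(t)e₀`, `q = −AΛ̇(t)p + A(0, −ξ̇(t))`, `ρ = ‖p̲‖`,
`D S(x)[e₀](u, u) = 2M(−⟪p̲, q̲⟫/ρ³ − 2⟪p̲, b̲⟫/ρ²)`. [cite: KerrSchild1965, §2] -/
theorem fderiv_summand_apply_self_eq (M : ℝ) {Λ : ℝ → lorentzGroup} {ξ : ℝ → E3} {t : ℝ}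
    (hΛ : ContDiff ℝ 1 (fun s ↦ ((Λ s : E4 ≃L[ℝ] E4) : E4 →L[ℝ] E4))) (hξ : ContDiff ℝ 1 ξ)
    {x : E4} (hx : x 0 = t) (hd : 1 ≤ ‖E4.spatial x - ξ t‖) :
    fderiv ℝ (fun y : E4 ↦ boostedKerrBilin (Λ (y 0)) (E4.ofTimeSpace (y 0) (ξ (y 0))) M 0 y -
        Minkowski.bilin) x (E4.basisVector 0) ((Λ t : E4 ≃L[ℝ] E4) (E4.basisVector 0))
        ((Λ t : E4 ≃L[ℝ] E4) (E4.basisVector 0)) =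
      2 * M * (-⟪E4.spatial ((((Λ t : E4 ≃L[ℝ] E4).symm : E4 →L[ℝ] E4))
            (E4.spaceEmbed (E4.spatial x - ξ t))),
          E4.spatial (-((((Λ t : E4 ≃L[ℝ] E4).symm : E4 →L[ℝ] E4))
            (deriv (fun s ↦ ((Λ s : E4 ≃L[ℝ] E4) : E4 →L[ℝ] E4)) t
              ((((Λ t : E4 ≃L[ℝ] E4).symm : E4 →L[ℝ] E4)) (E4.spaceEmbed (E4.spatial x - ξ t))))) +
            (((Λ t : E4 ≃L[ℝ] E4).symm : E4 →L[ℝ] E4)) (E4.spaceEmbed (-deriv ξ t)))⟫_ℝ /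
          E4.spatialNorm ((((Λ t : E4 ≃L[ℝ] E4).symm : E4 →L[ℝ] E4))
            (E4.spaceEmbed (E4.spatial x - ξ t))) ^ 3 -
        2 * ⟪E4.spatial ((((Λ t : E4 ≃L[ℝ] E4).symm : E4 →L[ℝ] E4))
            (E4.spaceEmbed (E4.spatial x - ξ t))),
          E4.spatial ((((Λ t : E4 ≃L[ℝ] E4).symm : E4 →L[ℝ] E4))
            (deriv (fun s ↦ ((Λ s : E4 ≃L[ℝ] E4) : E4 →L[ℝ] E4)) t (E4.basisVector 0)))⟫_ℝ /
          E4.spatialNorm ((((Λ t : E4 ≃L[ℝ] E4).symm : E4 →L[ℝ] E4))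
            (E4.spaceEmbed (E4.spatial x - ξ t))) ^ 2) := by
  have hd' : max 1 (2 * |(0 : ℝ)|) ≤ ‖E4.spatial x - ξ t‖ := by
    rw [abs_zero, mul_zero, max_eq_left zero_le_one]; exact hd
  have hS := (contDiffAt_summand (M := M) (a := 0) hΛ hξ hx hd').differentiableAt one_ne_zero
  have hz : E4.spatial x - ξ t ≠ 0 := norm_pos_iff.mp (one_pos.trans_le hd)
  exact fderiv_summand_basisVector_zero_apply hx hS _ _
    (hasDerivAt_schwarzschild_scalar_family M hΛ hξ (E4.spatial x) hz)

/-- `‖v̲‖ ≤ ‖v‖` for a vector of `E4`. [folklore] -/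
theorem wr_norm_spatial_le (v : E4) : ‖E4.spatial v‖ ≤ ‖v‖ := by
  have hsq : ‖v‖ ^ 2 = v 0 ^ 2 + ‖E4.spatial v‖ ^ 2 := by
    rw [EuclideanSpace.real_norm_sq_eq, Fin.sum_univ_four, ← E4.spatialNorm, E4.spatialNorm_sq]
    ring
  nlinarith [norm_nonneg v, norm_nonneg (E4.spatial v), sq_nonneg (v 0)]

/-- **Registered sub-goal form** (worker carrier `wr_bodyRate_spatial_antisymm` of the crux item) of
`inner_spatial_bodyRate_apply`: the spatial block of an `η`-antisymmetric operator is antisymmetric.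
[folklore] -/
theorem wr_bodyRate_spatial_antisymm : open Literature.Geometry.Lorentzian in ∀ (S : E4 →L[ℝ] E4), (∀ v w : E4, Minkowski.bilin (S v) w + Minkowski.bilin v (S w) = 0) → ∀ p : E4, inner ℝ (E4.spatial p) (E4.spatial (S p)) = p 0 * inner ℝ (E4.spatial p) (E4.spatial (S (E4.basisVector 0))) :=
  fun S hS p ↦ inner_spatial_bodyRate_apply S hS p

end Summit.FinalStateConjecture.FinalStateConjecture.Theorems.SublinearIsFree.WeightedRates

end
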